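import Literature.Probability.LatticeModels.AizenmanWickCurrentsExcess
import HarnessLib

/-!
# Aizenman's bound on the deviation from Wick's law by random currents — III: current ratios

Topic `Literature/Probability/LatticeModels`; conclusion of `AizenmanWickCurrents.lean` /
`AizenmanWickCurrentsExcess.lean`. Passing to the correlation ratios `W(A) = Z[A]/Z[∅]` (spelled
`wcurrentSum K A / wcurrentSum K ∅`, as in `TreeGraphWickTuples.lean`; `= ⟨σ_A⟩` of the corresponding Ising state;
pair matrix `tupleTwo W x` of that file) and feeding the one-step excess bound into
the greedy-pairing recursion `fsPairing_sub_le_of_step` of `TreeGraphWickBound.lean` gives **Aizenman's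
Proposition 12.1 for labelled points** (repetitions allowed): for edge couplings `K ≥ 0` on a finite simple graph,
`x : ι → V` and a label set `B` of even size,

  `𝒢[W₂](B) - W(oddSupp x B) ≤ (3/2) ∑_{s ⊆ B, |s| = 4} T(s) 𝒢[W₂](B ∖ s)`,     (`fsPairing_sub_ratio_oddSupp_le`)

`W₂(i,j) = W({x_i}Δ{x_j}) = ⟨σ_{x_i}σ_{x_j}⟩`, `W(oddSupp x B) = ⟨∏_{i∈B} σ_{x_i}⟩`, `𝒢 = fsPairing` (Wick's pairing
functional) and `T(s) = 2𝒫₄(s)/Z[∅]² = -U₄(x_{s₀},x_{s₁},x_{s₂},x_{s₃}) = |U₄|` at the increasing enumeration of `s`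
(`wickT_eq_neg_ursell`). Chain: `W(oddSupp B) ≥ S̃(B) := 𝔇(B;∅)/Z^{|B|/2}` (`dcRatio_le_ratio`, from
`dcMass_empty_mul_le`) and `𝒢(B) - S̃(B) ≤ (3/2) ℛ[T](B)` (the recursion, with the step
`gaussianStep_dcMass_le_three`).

## Relation to the tree

The named fact `aizenman_wickDeviation_le_finite` (`AizenmanWickBound.lean`) is discharged in
`AizenmanWickBoundProofs.lean` by the random-WALK route of the printed proof (exploration of currents, pendant graph
for coincident points). The present random-CURRENT route is an independent, shorter proof of the same inequality,
stated for arbitrary label subsets `B` of a linearly ordered index type (the interface of the greedy-pairing recursion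
of `TreeGraphWickBound.lean` / `TreeGraphWickTuples.lean`, with `|U₄|` and the constant `3/2` in place of the tree
diagram and the constant `2`/`8` there); on `B = univ ⊆ Fin (2n)` it is transported to `pairingSum` / `wickRemainder`
by `fsPairing_univ_eq_pairingSum` / `fsRemainder_univ_eq_wickRemainder` of `TreeGraphWickPairing.lean` exactly as in
`abs_ratio_oddSupport_sub_pairingSum_le` of `TreeGraphWickTuples.lean`. No named fact is introduced or restated.

## References

* M. Aizenman, Comm. Math. Phys. 86 (1982), Prop. 12.1, eq. (12.3) (upper bound) [AizenmanCMP1982] (read).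
* R. Panis, arXiv:2309.05797 (2023), Prop. 4.6 [Panis2023Triviality]; M. Aizenman, CDM 2020, Prop. 7.2
  [AizenmanCDM2020].
-/

noncomputable section

open Finset Filter
open scoped symmDiff ENNReal

namespace Literature.Probability.LatticeModels

namespace Current

variable {V : Type*} [Fintype V] [DecidableEq V] {G : SimpleGraph V} [DecidableRel G.Adj]
variable {ι : Type*} [LinearOrder ι]
variable {K : G.edgeFinset → ℝ}

section Ratio

variable (K) (x : ι → V)

/-- The normalised disjoint-cluster functional `S̃(I) = 𝔇(I;∅)/Z[∅]^{|I|/2}`. [folklore] -/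
def dcRatio (I : Finset ι) : ℝ := (dcMass K x I ∅).toReal / wcurrentSum K ∅ ^ (I.card / 2)

/-- The remainder kernel `T(s) = 2𝒫₄(s)/Z[∅]²` of a `4`-set of labels (`= |U₄(x_{s₀},…,x_{s₃})|`,
`wickT_eq_neg_ursell`). [cite: AizenmanCMP1982, Prop. 12.1 (definition of R_{2n})] -/
def wickT (s : Finset ι) : ℝ := 2 * (pfour K x s).toReal / wcurrentSum K ∅ ^ 2

end Ratio

variable {x : ι → V}

omit [LinearOrder ι] in
/-- `W₂ˣ ≥ 0` for the current ratios, `K ≥ 0`. [cite: GriffithsHurstSherman1970] -/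
theorem tupleTwo_ratio_nonneg (hK : ∀ e, 0 ≤ K e) (x : ι → V) (i j : ι) :
    0 ≤ tupleTwo (fun A => wcurrentSum K A / wcurrentSum K ∅) x i j :=
  div_nonneg (wcurrentSum_nonneg hK _) (wcurrentSum_nonneg hK ∅)

/-- `ℰ(I) = Z[∅]^{|I|/2} 𝒢[W₂](I)`: the unnormalised pairing functional in ratios. [folklore] -/
theorem toReal_epairing (hK : ∀ e, 0 ≤ K e) (x : ι → V) :
    ∀ I : Finset ι, (epairing K x I).toReal = wcurrentSum K ∅ ^ (I.card / 2) * fsPairing (tupleTwo (fun A => wcurrentSum K A / wcurrentSum K ∅) x) I := by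
  intro I
  induction I using Finset.strongInduction with
  | H I ih =>
    by_cases hI : I.Nonempty
    swap
    · rw [Finset.not_nonempty_iff_eq_empty.1 hI, epairing_empty, fsPairing_empty, Finset.card_empty]; simp
    have hmI := I.min'_mem hI
    rw [epairing_eq hI, fsPairing_eq _ hI, Finset.mul_sum,
      ENNReal.toReal_sum (fun b _ => ENNReal.mul_ne_top (ecurrentSum_ne_top hK _) (epairing_ne_top hK x _))]
    refine Finset.sum_congr rfl fun b hb => ?_
    have hcard : I.card / 2 = ((I.erase (I.min' hI)).erase b).card / 2 + 1 := by
      rw [Finset.card_erase_of_mem hb, Finset.card_erase_of_mem hmI]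
      have h2 : 2 ≤ I.card := by
        have := Finset.card_pos.2 ⟨b, hb⟩
        rw [Finset.card_erase_of_mem hmI] at this; omega
      omega
    rw [ENNReal.toReal_mul, toReal_ecurrentSum hK, ih _ (erase_erase_ssubset hmI b), hcard, pow_succ, tupleTwo]
    have h0 : wcurrentSum K (∅ : Finset V) ≠ 0 := (wcurrentSum_empty_pos hK).ne'
    field_simp

/-- `S̃(∅) = 1`. [folklore] -/
theorem dcRatio_empty (x : ι → V) : dcRatio K x (∅ : Finset ι) = 1 := by
  simp [dcRatio]

/-- **`S̃ ≤ W`**: `𝔇(I;∅)/Z^{|I|/2} ≤ W(oddSupp x I)` (`dcMass_empty_mul_le`). [cite: AizenmanCMP1982, Prop. 12.1 with Lemmas 9.2–9.3] -/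
theorem dcRatio_le_ratio (hK : ∀ e, 0 ≤ K e) (x : ι → V) (I : Finset ι) :
    dcRatio K x I ≤ wcurrentSum K (oddSupp x I) / wcurrentSum K ∅ := by
  have h := dcMass_empty_mul_le hK x I
  have htop : ecurrentSum K (oddSupp x I) * ecurrentSum K ∅ ^ (I.card / 2) ≠ ∞ :=
    ENNReal.mul_ne_top (ecurrentSum_ne_top hK _) (ENNReal.pow_ne_top (ecurrentSum_ne_top hK _))
  have h' := ENNReal.toReal_mono htop h
  rw [ENNReal.toReal_mul, ENNReal.toReal_mul, ENNReal.toReal_pow, toReal_ecurrentSum hK, toReal_ecurrentSum hK] at h'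
  have h0 : 0 < wcurrentSum K (∅ : Finset V) := wcurrentSum_empty_pos hK
  rw [dcRatio, div_le_div_iff₀ (pow_pos h0 _) h0]
  linarith

/-- `T ≥ 0`. [folklore] -/
theorem wickT_nonneg (hK : ∀ e, 0 ≤ K e) (x : ι → V) (s : Finset ι) : 0 ≤ wickT K x s :=
  div_nonneg (mul_nonneg zero_le_two ENNReal.toReal_nonneg) (pow_nonneg (wcurrentSum_nonneg hK ∅) 2)

/-- `𝒫₄(s) < ∞`. [folklore] -/
theorem pfour_ne_top (hK : ∀ e, 0 ≤ K e) (x : ι → V) (s : Finset ι) : pfour K x s ≠ ∞ := by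
  unfold pfour
  split_ifs
  · exact ne_top_of_le_ne_top (ENNReal.mul_ne_top (ecurrentSum_ne_top hK _) (ecurrentSum_ne_top hK _)) (Pint_le_mul K _ _ _ _)
  · exact ENNReal.zero_ne_top

/-- **The one-step excess bound in ratios**: for `B` nonempty of even size, `m = min B`,
`∑_{j∈B∖m} W₂(m,j) S̃(B∖{m,j}) - S̃(B) ≤ (3/2) ∑_{t⊆B∖m,|t|=3} T({m}∪t) 𝒢[W₂](B∖({m}∪t))` — the hypothesis
`hstep` of `fsPairing_sub_le_of_step` (from `gaussianStep_dcMass_le_three`). [cite: AizenmanCMP1982, Prop. 12.1 (proof)] -/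
theorem dcRatio_step (hK : ∀ e, 0 ≤ K e) (x : ι → V) (B : Finset ι) (hB : B.Nonempty) (hev : Even B.card) :
    ∑ j ∈ B.erase (B.min' hB), tupleTwo (fun A => wcurrentSum K A / wcurrentSum K ∅) x (B.min' hB) j * dcRatio K x ((B.erase (B.min' hB)).erase j) - dcRatio K x B ≤
      3 / 2 * ∑ t ∈ (B.erase (B.min' hB)).powersetCard 3,
        wickT K x (insert (B.min' hB) t) * fsPairing (tupleTwo (fun A => wcurrentSum K A / wcurrentSum K ∅) x) (B \ insert (B.min' hB) t) := by
  set m := B.min' hB with hm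
  set B' := B.erase m with hB'
  set Z0 : ℝ := wcurrentSum K ∅ with hZ0
  have hmB : m ∈ B := B.min'_mem hB
  have hmB' : m ∉ B' := Finset.notMem_erase m B
  have h0 : 0 < Z0 := wcurrentSum_empty_pos hK
  obtain ⟨k, hk⟩ : ∃ k, B.card = 2 * k := by rcases hev with ⟨r, hr⟩; exact ⟨r, by omega⟩
  have hk1 : 1 ≤ k := by have := Finset.card_pos.2 hB; omega
  have hcardB : B.card / 2 = k := by omega
  -- the unnormalised inequality, in `ℝ`
  have h := gaussianStep_dcMass_le_three hK x hB
  have hRtop : dcMass K x B ∅ + 3 * ∑ t ∈ B'.powersetCard 3, pfour K x (insert m t) * epairing K x (B' \ t) ≠ ∞ :=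
    ENNReal.add_ne_top.2 ⟨dcMass_ne_top hK x B ∅, ENNReal.mul_ne_top ENNReal.ofNat_ne_top
      (ENNReal.sum_ne_top.2 fun t _ => ENNReal.mul_ne_top (pfour_ne_top hK x _) (epairing_ne_top hK x _))⟩
  have h' := ENNReal.toReal_mono hRtop h
  rw [ENNReal.toReal_sum (fun j _ => ENNReal.mul_ne_top (ecurrentSum_ne_top hK _) (dcMass_ne_top hK x _ ∅)),
    ENNReal.toReal_add (dcMass_ne_top hK x B ∅) (ENNReal.mul_ne_top ENNReal.ofNat_ne_top
      (ENNReal.sum_ne_top.2 fun t _ => ENNReal.mul_ne_top (pfour_ne_top hK x _) (epairing_ne_top hK x _))),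
    ENNReal.toReal_mul, ENNReal.toReal_sum (fun t _ => ENNReal.mul_ne_top (pfour_ne_top hK x _) (epairing_ne_top hK x _)),
    ENNReal.toReal_ofNat] at h'
  simp only [ENNReal.toReal_mul, toReal_ecurrentSum hK, toReal_epairing hK x] at h'
  -- rewrite every term as ratio × power of `Z0`
  have hterm1 : ∀ j ∈ B', wcurrentSum K ({x m} ∆ {x j}) * (dcMass K x (B'.erase j) ∅).toReal =
      tupleTwo (fun A => wcurrentSum K A / wcurrentSum K ∅) x m j * dcRatio K x (B'.erase j) * Z0 ^ k := by
    intro j hj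
    have hc : (B'.erase j).card / 2 = k - 1 := by
      rw [Finset.card_erase_of_mem hj, hB', Finset.card_erase_of_mem hmB]; omega
    rw [tupleTwo, dcRatio, hc, ← hZ0]
    have : Z0 ^ k = Z0 ^ (k - 1) * Z0 := by rw [← pow_succ]; congr 1; omega
    rw [this]
    field_simp
  have hterm2 : (dcMass K x B ∅).toReal = dcRatio K x B * Z0 ^ k := by
    rw [dcRatio, hcardB, ← hZ0, div_mul_cancel₀ _ (pow_ne_zero _ h0.ne')]
  have hterm3 : ∀ t ∈ B'.powersetCard 3, (pfour K x (insert m t)).toReal *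
      (Z0 ^ ((B' \ t).card / 2) * fsPairing (tupleTwo (fun A => wcurrentSum K A / wcurrentSum K ∅) x) (B' \ t)) =
      (1 / 2) * (wickT K x (insert m t) * fsPairing (tupleTwo (fun A => wcurrentSum K A / wcurrentSum K ∅) x) (B \ insert m t)) * Z0 ^ k := by
    intro t ht
    have htB' : t ⊆ B' := (Finset.mem_powersetCard.1 ht).1
    have ht3 : t.card = 3 := (Finset.mem_powersetCard.1 ht).2
    have hc : (B' \ t).card / 2 = k - 2 := by
      rw [Finset.card_sdiff_of_subset htB', ht3, hB', Finset.card_erase_of_mem hmB]; omega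
    have hk2 : 2 ≤ k := by
      have := Finset.card_le_card htB'
      rw [ht3, hB', Finset.card_erase_of_mem hmB] at this; omega
    have hsd : B \ insert m t = B' \ t := by
      ext w
      simp only [hB', Finset.mem_sdiff, Finset.mem_insert, Finset.mem_erase, not_or]
      tauto
    rw [hsd, hc, wickT, ← hZ0]
    have : Z0 ^ k = Z0 ^ (k - 2) * Z0 ^ 2 := by rw [← pow_add]; congr 1; omega
    rw [this]
    field_simp
  rw [Finset.sum_congr rfl hterm1, hterm2, Finset.sum_congr rfl hterm3, ← Finset.sum_mul, ← Finset.sum_mul,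
    ← Finset.mul_sum] at h'
  -- divide by `Z0 ^ k`
  have hpow : 0 < Z0 ^ k := pow_pos h0 k
  have key : (∑ j ∈ B', tupleTwo (fun A => wcurrentSum K A / wcurrentSum K ∅) x m j * dcRatio K x (B'.erase j)) * Z0 ^ k ≤
      (dcRatio K x B + 3 / 2 * ∑ t ∈ B'.powersetCard 3,
        wickT K x (insert m t) * fsPairing (tupleTwo (fun A => wcurrentSum K A / wcurrentSum K ∅) x) (B \ insert m t)) * Z0 ^ k := by
    calc (∑ j ∈ B', tupleTwo (fun A => wcurrentSum K A / wcurrentSum K ∅) x m j * dcRatio K x (B'.erase j)) * Z0 ^ k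
        ≤ dcRatio K x B * Z0 ^ k + 3 * (1 / 2 * (∑ t ∈ B'.powersetCard 3,
            wickT K x (insert m t) * fsPairing (tupleTwo (fun A => wcurrentSum K A / wcurrentSum K ∅) x) (B \ insert m t)) * Z0 ^ k) := h'
      _ = _ := by ring
  have key' := le_of_mul_le_mul_right key hpow
  linarith

/-- **Aizenman's Proposition 12.1 for labelled points, in current ratios** (the random-current proof of this
file series): for edge couplings `K ≥ 0` on a finite simple graph, points `x : ι → V` (repetitions allowed) and a
label set `B` of even size,
`𝒢[W₂](B) - W(oddSupp x B) ≤ (3/2) ∑_{s⊆B,|s|=4} T(s) 𝒢[W₂](B∖s)`, with `W₂(i,j) = ⟨σ_{x_i}σ_{x_j}⟩`,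
`W(oddSupp x B) = ⟨∏_{i∈B}σ_{x_i}⟩` (ratios `Z[·]/Z[∅]`), `𝒢 = fsPairing`, `T = wickT = |U₄|` (`wickT_eq_neg_ursell`).
[cite: AizenmanCMP1982, Prop. 12.1, eq. (12.3) (upper bound)] [cite: Panis2023Triviality, Prop. 4.6] -/
theorem fsPairing_sub_ratio_oddSupp_le (hK : ∀ e, 0 ≤ K e) (x : ι → V) {B : Finset ι} (hB : Even B.card) :
    fsPairing (tupleTwo (fun A => wcurrentSum K A / wcurrentSum K ∅) x) B - wcurrentSum K (oddSupp x B) / wcurrentSum K ∅ ≤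
      3 / 2 * fsRemainder (wickT K x) (tupleTwo (fun A => wcurrentSum K A / wcurrentSum K ∅) x) B := by
  have h := fsPairing_sub_le_of_step (S₂ := tupleTwo (fun A => wcurrentSum K A / wcurrentSum K ∅) x) (T := wickT K x)
    (S := dcRatio K x) (c := 3 / 2) (tupleTwo_ratio_nonneg hK x) (dcRatio_empty (K := K) x).ge
    (fun B hB hev => dcRatio_step hK x B hB hev) B hB
  have h2 := dcRatio_le_ratio hK x B
  linarith

/-- **The remainder kernel is `|U₄|`**: for a `4`-set `s = {s₀<s₁<s₂<s₃}` of labels with points `uₖ = x_{sₖ}`,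
`T(s) = W(u₀u₁)W(u₂u₃) + W(u₀u₂)W(u₁u₃) + W(u₀u₃)W(u₁u₂) - W({u₀}Δ{u₁}Δ{u₂}Δ{u₃}) = -U₄(u₀,u₁,u₂,u₃)`
(the Ursell identity `ursellFour_currentSum_identity`, divided by `Z[∅]²`). [cite: Panis2023Triviality, Proposition 4.7] -/
theorem wickT_eq_neg_ursell (hK : ∀ e, 0 ≤ K e) (x : ι → V) {s : Finset ι} (hs : s.card = 4) :
    wickT K x s =
      wcurrentSum K ({x (s.orderEmbOfFin hs 0)} ∆ {x (s.orderEmbOfFin hs 1)}) / wcurrentSum K ∅ *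
          (wcurrentSum K ({x (s.orderEmbOfFin hs 2)} ∆ {x (s.orderEmbOfFin hs 3)}) / wcurrentSum K ∅) +
        wcurrentSum K ({x (s.orderEmbOfFin hs 0)} ∆ {x (s.orderEmbOfFin hs 2)}) / wcurrentSum K ∅ *
          (wcurrentSum K ({x (s.orderEmbOfFin hs 1)} ∆ {x (s.orderEmbOfFin hs 3)}) / wcurrentSum K ∅) +
        wcurrentSum K ({x (s.orderEmbOfFin hs 0)} ∆ {x (s.orderEmbOfFin hs 3)}) / wcurrentSum K ∅ *
          (wcurrentSum K ({x (s.orderEmbOfFin hs 1)} ∆ {x (s.orderEmbOfFin hs 2)}) / wcurrentSum K ∅) -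
        wcurrentSum K ({x (s.orderEmbOfFin hs 0)} ∆ ({x (s.orderEmbOfFin hs 1)} ∆ ({x (s.orderEmbOfFin hs 2)} ∆ {x (s.orderEmbOfFin hs 3)}))) /
          wcurrentSum K ∅ := by
  set a := x (s.orderEmbOfFin hs 0)
  set b := x (s.orderEmbOfFin hs 1)
  set c := x (s.orderEmbOfFin hs 2)
  set d := x (s.orderEmbOfFin hs 3)
  have hid : ecurrentSum K ({a} ∆ {b}) * ecurrentSum K ({c} ∆ {d}) + ecurrentSum K ({a} ∆ {c}) * ecurrentSum K ({b} ∆ {d}) +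
      ecurrentSum K ({a} ∆ {d}) * ecurrentSum K ({b} ∆ {c}) =
      ecurrentSum K ({a} ∆ ({b} ∆ ({c} ∆ {d}))) * ecurrentSum K ∅ + 2 * Pint K a b c d :=
    ursellFour_currentSum_identity hK a b c d
  have hpf : pfour K x s = Pint K a b c d := by rw [pfour, dif_pos hs]
  have htop : ecurrentSum K ({a} ∆ ({b} ∆ ({c} ∆ {d}))) * ecurrentSum K ∅ + 2 * Pint K a b c d ≠ ∞ :=
    ENNReal.add_ne_top.2 ⟨ENNReal.mul_ne_top (ecurrentSum_ne_top hK _) (ecurrentSum_ne_top hK _),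
      ENNReal.mul_ne_top ENNReal.ofNat_ne_top (hpf ▸ pfour_ne_top hK x s)⟩
  have h := congrArg ENNReal.toReal hid
  rw [ENNReal.toReal_add (ENNReal.mul_ne_top (ecurrentSum_ne_top hK _) (ecurrentSum_ne_top hK _))
      (ENNReal.mul_ne_top ENNReal.ofNat_ne_top (hpf ▸ pfour_ne_top hK x s)),
    ENNReal.toReal_add (ENNReal.add_ne_top.2 ⟨ENNReal.mul_ne_top (ecurrentSum_ne_top hK _) (ecurrentSum_ne_top hK _),
      ENNReal.mul_ne_top (ecurrentSum_ne_top hK _) (ecurrentSum_ne_top hK _)⟩)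
      (ENNReal.mul_ne_top (ecurrentSum_ne_top hK _) (ecurrentSum_ne_top hK _)),
    ENNReal.toReal_add (ENNReal.mul_ne_top (ecurrentSum_ne_top hK _) (ecurrentSum_ne_top hK _))
      (ENNReal.mul_ne_top (ecurrentSum_ne_top hK _) (ecurrentSum_ne_top hK _))] at h
  simp only [ENNReal.toReal_mul, toReal_ecurrentSum hK, ENNReal.toReal_ofNat] at h
  rw [wickT, hpf]
  have h0 : wcurrentSum K (∅ : Finset V) ≠ 0 := (wcurrentSum_empty_pos hK).ne'
  field_simp
  linarith

end Current

end Literature.Probability.LatticeModels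

end
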